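import Summits.Ventures.PercRepro.GenQOpenLayersCoreSmall

/-!
# PercRepro — the rank-`5` flats of the core have `≤ 21` points once the rank-`4` flats have `≤ 10` (night-2, gen 4)

`f(5) ≤ 2·f(4) + 1`: night-3's cover `exists_cover_erase_of_core` writes a rank-`5` flat `F` of a Core matroid as a point
plus two flats of rank `< 5`; flats of rank `≤ 3` have `≤ 7` points (`card_add_one_le_two_pow_of_core`), and the
rank-`4` bound `f(4) ≤ 10` (mine-4's proof from kernel facts, typed by p2 as `card_le_ten_of_core`) is taken as a
hypothesis here: `card_le_twentyone_of_core_of_ten`.  Imports `GenQOpenLayersCoreSmall` only.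
-/
namespace PercRepro.Star

open Finset ThmH PerFlat NightThree

variable {α : Type*} [DecidableEq α] {M : Matroid α} [M.Finite]

/-- **`f(5) ≤ 2·f(4) + 1`**: if every rank-`4` flat of the core has `≤ 10` points, every rank-`5` flat has `≤ 21`. -/
theorem card_le_twentyone_of_core_of_ten {p : ℕ} (hc : Core M p)
    (h10 : ∀ F ∈ flatsQ M 4, F.card ≤ 10) {F : Finset α} (hF : F ∈ flatsQ M 5) : F.card ≤ 21 := by
  rcases F.eq_empty_or_nonempty with hemp | ⟨e, he⟩
  · rw [hemp, Finset.card_empty]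
    omega
  obtain ⟨F₁, F₂, r₁, r₂, hr₁, hr₂, hF₁, hF₂, _, _, hcov⟩ := exists_cover_erase_of_core hc hF he
  have hpart : ∀ (r : ℕ) (G : Finset α), r < 5 → G ∈ flatsQ M r → G.card ≤ 10 := by
    intro r G hr hG
    rcases (show r = 4 ∨ r ≤ 3 by omega) with h4 | h3
    · subst h4
      exact h10 G hG
    · have h := card_add_one_le_two_pow_of_core hc r G hG
      have h8 : 2 ^ r ≤ 2 ^ 3 := Nat.pow_le_pow_right (by norm_num) h3
      omega
  have h1 := hpart r₁ F₁ hr₁ hF₁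
  have h2 := hpart r₂ F₂ hr₂ hF₂
  have hcard : F.card = (F.erase e).card + 1 := by rw [Finset.card_erase_add_one he]
  have hle : (F.erase e).card ≤ F₁.card + F₂.card :=
    (Finset.card_le_card hcov).trans (Finset.card_union_le _ _)
  omega

end PercRepro.Star
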